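import Summits.Ventures.Crystal3D.Theorems.StickyWulffConstantGenericWallFloorCubicCoords
import HarnessLib

/-!
# The two-centre SHELL ROW of lane G: predicate text (crux `GenericWallFloor`, stmt-Ventures-19480, line `WallLedgerG`;
# PREREG-G-TWOCENTRE §7–§8, HOME/wall-p1-g8/prereg/; commissioned cf-p1 g28 17:22:54Z (xxxix))

HONEST FRAMING. Venture `Summits/Ventures/Crystal3D` (cell `crystal3d-full`), helper vocabulary for the crux `GenericWallFloor`
of `route-Ventures-StickyWulffConstant`, REGISTERED line `WallLedgerG`, open stub `stub_twoSlabAdhesion`.  DEFINITIONS ONLY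
(the G analogue of `…CoaxialWallLawEndRowDefs`): the census engine (cf-p2) certifies `ShellRowHolds C` for the seven classes
below; the walker ledger consumes `IsShellBlocked X C z → #contacts(z) ≤ C.bound`.  Nothing is proved about packings here;
F-C1 not moved.

* `cubicVecQ q` — the vector with cubic coordinates `q/√2` (`q : Fin 3 → ℚ`; integer triples of norm² 2 are the twelve slots,
  cf. `slotInt`/`slotSite` of `…CubicCoords`/`…CutNormals`);
* `ShellClass` — a finite list of RELATIVE positions (scaled cubic coordinates) and a degree bound;
* `IsShellBlocked X C z` — some isometric copy of the class configuration sits around `z` inside `X`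
  (`∃ G, ∀ q ∈ C.present, z + G (cubicVecQ q) ∈ X`);
* `ShellRowHolds C` — THE ROW: in every unit packing, a ball carrying the configuration has at most `C.bound` contacts;
* the seven concrete classes (PREREG §8) live in a separate DATA file (`…ShellRowClasses`, draft in HOME/wall-p1-g8/ until
  cf-p2 confirms the cut), so that this vocabulary file stays stable.
WHAT THIS IS NOT: no certificate, no ledger, no class data; F-C1 not moved.
-/

noncomputable section

namespace Summit.Ventures.Crystal3D.Theorems

open Finset
open scoped InnerProductSpace

/-- The vector of `ℝ³` whose CUBIC coordinates (w.r.t. the orthonormal `cubicFrame`) are `q / √2`. -/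
def cubicVecQ (q : Fin 3 → ℚ) : EuclideanSpace ℝ (Fin 3) :=
  ∑ i : Fin 3, (((q i : ℚ) : ℝ) / Real.sqrt 2) • cubicFrame i

/-- A SHELL CLASS: the certified balls around the centre (relative scaled cubic coordinates: contacts have norm² 2, the
√2-shell has norm² 8/3, 10/3 or 4) and the degree bound the census certifies. -/
structure ShellClass where
  /-- relative positions (scaled cubic coordinates) of the balls whose presence is certified -/
  present : List (Fin 3 → ℚ)
  /-- the certified maximal number of contacts of the centre -/
  bound : ℕ

variable (X : Finset (EuclideanSpace ℝ (Fin 3)))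

/-- `z` CARRIES the class `C` in `X`: an isometric copy of the class configuration centred at `z` lies in `X`. -/
def IsShellBlocked (C : ShellClass) (z : EuclideanSpace ℝ (Fin 3)) : Prop :=
  ∃ G : EuclideanSpace ℝ (Fin 3) ≃ₗᵢ[ℝ] EuclideanSpace ℝ (Fin 3), ∀ q ∈ C.present, z + G (cubicVecQ q) ∈ X

/-- **The shell row** for the class `C`: in every unit packing, a ball carrying `C` has at most `C.bound` contacts. -/
def ShellRowHolds (C : ShellClass) : Prop :=
  ∀ (Y : Finset (EuclideanSpace ℝ (Fin 3))), (∀ p ∈ Y, ∀ q ∈ Y, p ≠ q → 1 ≤ dist p q) →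
    ∀ z ∈ Y, IsShellBlocked Y C z → (Y.filter fun q => dist z q = 1).card ≤ C.bound

/-- Unfolding lemma for the consumer: a certified row bounds the contacts of every carrier. -/
theorem card_contacts_le_of_shellRow {C : ShellClass} (hC : ShellRowHolds C)
    (hX : ∀ p ∈ X, ∀ q ∈ X, p ≠ q → 1 ≤ dist p q) {z : EuclideanSpace ℝ (Fin 3)} (hz : z ∈ X)
    (h : IsShellBlocked X C z) : (X.filter fun q => dist z q = 1).card ≤ C.bound :=
  hC X hX z hz h

end Summit.Ventures.Crystal3D.Theorems

end
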